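import Literature.Analysis.FluidPDE.CriticalSpacesProofs
import Literature.Analysis.FunctionSpaces.BesovWeakStarLimits
import Literature.Analysis.FunctionSpaces.GaussianSchwartz
import HarnessLib

/-!
# Tempered distributions of locally integrable fields; local limits of Besov-bounded fields

Analysis/FluidPDE proof file (theorems only: no definition, no named fact). Two pieces of glue
between vector fields `E → ℝ^ι` and their tempered distributions (`IsDistributionOf`,
`CriticalSpaces.lean`), consumed by the blow-up arguments for the critical Besov regularity
criteria (W. Wang, Z. Zhang, arXiv:1510.02589, §4 Step 1; D. Albritton, arXiv:1612.04439, §3):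

* `exists_isDistributionOf_of_forall_integrable` — **`L¹_loc ∩ 𝓢' ⊂ 𝓢'`**: a measurable field `w`
  with `θ • w ∈ L¹` for every Schwartz `θ` has a tempered distribution (the functionals
  `θ ↦ ∫_{‖x‖ ≤ n} θ • w` are tempered distributions — `L¹ ⊂ 𝓢'` — converging pointwise to
  `θ ↦ ∫ θ • w` by dominated convergence, and a pointwise limit of tempered distributions is one,
  Banach–Steinhaus on the barrelled space `𝓢`, Mathlib's `continuousLinearMapOfTendsto`). This is
  the embedding the docstring of `IsDistributionOf` says Mathlib lacks, for the fields of interest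
  (e.g. uniformly locally square integrable slices of blow-up limits);
* `exists_tendsto_isDistributionOf_of_tendsto_integral` — **local limits of Besov-bounded
  fields**: if fields `u n` with distributions `U n ∈ Ḃ^s_{p,q}`, `‖U n‖_{Ḃ^s_{p,q}} ≤ M`
  (`-2 < s < 0`, `q ≠ 0`), converge against compactly supported Schwartz functions to a field `w`
  as above, then `U n → W` in `𝓢'`, `W` is the distribution of `w`, and
  `W ∈ Ḃ^s_{p,q}` with `‖W‖_{Ḃ^s_{p,q}} ≤ M` ("the lower semi-continuity of the norm gives
  `‖v(t)‖_{Ḃ^{-1+3/p}_{p,q}} ≤ M`", Wang–Zhang §4 Step 1) — the packaging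
  `FunctionSpaces.exists_tendsto_of_forall_hasCompactSupport_tendsto'` plus the identification of the
  limit through compactly supported tests.

## References

* W. Wang, Z. Zhang, Sci. China Math. 60 (2017) 637–650 = arXiv:1510.02589, §4 Step 1.
  [WangZhang2016]
* H. Bahouri, J.-Y. Chemin, R. Danchin, *Fourier Analysis and Nonlinear PDE* (2011), §1.2,
  Thm. 2.25. [BahouriCheminDanchin2011]
* W. Rudin, *Functional Analysis* (1991), Thm. 2.8 (Banach–Steinhaus: pointwise limits of
  continuous linear maps on a barrelled space). [Rudin1991]
-/

noncomputable section

open MeasureTheory Filter Set Function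
open _root_.Topology
open scoped SchwartzMap ENNReal NNReal

namespace Literature.Analysis.FluidPDE

open FunctionSpaces.EuclideanSpace (complexify)

variable {ι : Type*} [Fintype ι] {E : Type*} [NormedAddCommGroup E] [InnerProductSpace ℝ E]
  [FiniteDimensional ℝ E] [MeasurableSpace E] [BorelSpace E]

/-! ## `L¹_loc ∩ 𝓢' ⊂ 𝓢'` -/

/-- A field with `θ • w ∈ L¹` for the Gaussian `θ = e^{-‖x‖²}` is integrable on every ball.
[folklore] -/
theorem integrableOn_closedBall_of_integrable_gaussian_smul {w : E → EuclideanSpace ℝ ι}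
    (hwm : AEStronglyMeasurable w volume)
    (hw : Integrable (fun x => (FunctionSpaces.gaussianSchwartz E 1) x • complexify (w x))) (R : ℝ) :
    IntegrableOn w (Metric.closedBall (0 : E) R) volume := by
  have hpos : (0 : ℝ) < 1 := one_pos
  -- `‖w x‖ ≤ e^{R²} ‖e^{-‖x‖²} • complexify (w x)‖` on the ball
  refine Integrable.mono' ((hw.norm.const_mul (Real.exp (R ^ 2))).integrableOn) hwm.restrict ?_
  refine (ae_restrict_mem Metric.isClosed_closedBall.measurableSet).mono fun x hx => ?_
  rw [Metric.mem_closedBall, dist_zero_right] at hx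
  rw [FunctionSpaces.gaussianSchwartz_apply hpos, norm_smul, Complex.norm_real, Real.norm_eq_abs,
    abs_of_pos (Real.exp_pos _), FunctionSpaces.EuclideanSpace.norm_complexify, ← mul_assoc,
    ← Real.exp_add]
  have h : 0 ≤ R ^ 2 + -1 * ‖x‖ ^ 2 := by nlinarith [norm_nonneg x, sq_nonneg (R - ‖x‖), sq_abs R]
  calc ‖w x‖ = 1 * ‖w x‖ := (one_mul _).symm
    _ ≤ Real.exp (R ^ 2 + -1 * ‖x‖ ^ 2) * ‖w x‖ :=
        mul_le_mul_of_nonneg_right (Real.one_le_exp h) (norm_nonneg _)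

/-- **`L¹_loc ∩ 𝓢' ⊂ 𝓢'`: a measurable field whose products with all Schwartz functions are
integrable has a tempered distribution** (`IsDistributionOf w U`): the truncations
`w 𝟙_{‖x‖ ≤ n} ∈ L¹` have tempered distributions (`exists_isDistributionOf_of_memLp`-style, here
through `integrableOn_closedBall_of_integrable_gaussian_smul`), their pairings
`∫_{‖x‖ ≤ n} θ • w → ∫ θ • w` (dominated convergence), and the pointwise limit of a sequence of
tempered distributions is a tempered distribution (Banach–Steinhaus on the barrelled space `𝓢`,
Mathlib's `continuousLinearMapOfTendsto`). [cite: Rudin1991, Thm 2.8] -/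
theorem exists_isDistributionOf_of_forall_integrable {w : E → EuclideanSpace ℝ ι}
    (hwm : AEStronglyMeasurable w volume)
    (hw : ∀ θ : 𝓢(E, ℂ), Integrable (fun x => θ x • complexify (w x))) :
    ∃ U : 𝓢'(E, EuclideanSpace ℂ ι), IsDistributionOf w U := by
  haveI : BarrelledSpace ℂ 𝓢(E, ℂ) := FunctionSpaces.barrelledSpace_schwartzMap
  -- the truncations and their `L¹` classes
  set B : ℕ → Set E := fun n => Metric.closedBall (0 : E) n with hB
  have hBm : ∀ n, MeasurableSet (B n) := fun n => Metric.isClosed_closedBall.measurableSet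
  have hint : ∀ n, Integrable ((B n).indicator w) volume := fun n =>
    (integrableOn_closedBall_of_integrable_gaussian_smul hwm (hw _) n).integrable_indicator (hBm n)
  haveI : Fact ((1 : ℝ≥0∞) ≤ 1) := ⟨le_rfl⟩
  have hmem : ∀ n, MemLp ((B n).indicator w) 1 volume := fun n => memLp_one_iff_integrable.2 (hint n)
  -- the truncated distributions and their pairings
  obtain hU := fun n => isDistributionOf_toTemperedDistribution (hmem n)
  set U : ℕ → 𝓢'(E, EuclideanSpace ℂ ι) := fun n =>
    Lp.toTemperedDistribution ((memLp_complexify_comp (hmem n)).toLp _) with hUdef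
  have hUθ : ∀ n θ, U n θ = ∫ x, θ x • complexify ((B n).indicator w x) := fun n θ =>
    ((hU n) θ).2
  -- pointwise convergence `⟨U n, θ⟩ → ∫ θ • w` (dominated convergence)
  have hlimθ : ∀ θ : 𝓢(E, ℂ),
      Tendsto (fun n => U n θ) atTop (𝓝 (∫ x, θ x • complexify (w x))) := by
    intro θ
    simp_rw [hUθ]
    refine tendsto_integral_of_dominated_convergence (fun x => ‖θ x • complexify (w x)‖)
      (fun n => ?_) (hw θ).norm (fun n => ae_of_all _ fun x => ?_) (ae_of_all _ fun x => ?_)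
    · exact (θ.continuous.aestronglyMeasurable.smul
        (FunctionSpaces.EuclideanSpace.continuous_complexify.comp_aestronglyMeasurable
          (hwm.indicator (hBm n))))
    · by_cases hxB : x ∈ B n
      · rw [Set.indicator_of_mem hxB]
      · rw [Set.indicator_of_notMem hxB]
        simp
    · -- eventually `x ∈ B n`
      have hx : ∀ᶠ n : ℕ in atTop, x ∈ B n := by
        refine (tendsto_natCast_atTop_atTop.eventually_ge_atTop ‖x‖).mono fun n hn => ?_
        simpa [hB, Metric.mem_closedBall, dist_zero_right] using hn
      refine tendsto_const_nhds.congr' (hx.mono fun n hn => ?_)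
      simp only [Set.indicator_of_mem hn]
  -- Banach–Steinhaus: the pointwise limit is a tempered distribution
  let 𝓕 : ℕ → 𝓢(E, ℂ) →L[ℂ] EuclideanSpace ℂ ι := fun n =>
    (UniformConvergenceCLM.ofFun (RingHom.id ℂ) (EuclideanSpace ℂ ι)
      {S : Set 𝓢(E, ℂ) | S.Finite}).symm (U n)
  have h𝓕 : ∀ n θ, 𝓕 n θ = U n θ := fun _ _ => rfl
  have hlim : Tendsto (fun n θ => 𝓕 n θ) atTop (𝓝 fun θ => ∫ x, θ x • complexify (w x)) :=
    tendsto_pi_nhds.2 fun θ => by simpa only [h𝓕] using hlimθ θ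
  let V₀ : 𝓢(E, ℂ) →L[ℂ] EuclideanSpace ℂ ι := continuousLinearMapOfTendsto 𝓕 hlim
  have hV₀ : ∀ θ, V₀ θ = ∫ x, θ x • complexify (w x) := fun _ => rfl
  let V : 𝓢'(E, EuclideanSpace ℂ ι) :=
    ContinuousLinearMap.toPointwiseConvergenceCLM ℂ (RingHom.id ℂ) 𝓢(E, ℂ) (EuclideanSpace ℂ ι) V₀
  have hV : ∀ θ, V θ = ∫ x, θ x • complexify (w x) := fun _ => rfl
  exact ⟨V, fun θ => ⟨hw θ, hV θ⟩⟩

/-! ## Local limits of Besov-bounded fields -/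

/-- **Local limits of fields with bounded critical Besov norms** (Wang–Zhang 2017, §4 Step 1:
"`u^k → v` in `C([-T,0]; L^{9/8}(B_a))` … the lower semi-continuity of the norm gives
`‖v‖ ≤ M`"; BCD Thm. 2.25 packaged): let `u n : E → ℝ^ι` have tempered distributions
`U n ∈ Ḃ^s_{p,q}` with `‖U n‖_{Ḃ^s_{p,q}} ≤ M` (`-2 < s < 0`, `1 ≤ p ≤ ∞`, `q ≠ 0`), and let them
converge to a measurable field `w` with `θ • w ∈ L¹` for all Schwartz `θ`, in the weak local sense
`∫ θ • u n → ∫ θ • w` for every **compactly supported** Schwartz `θ` (e.g. `u n → w` in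
`L¹_loc`). Then the distributions converge, `U n → W` in `𝓢'`, to the distribution `W` of `w`, and
`W ∈ Ḃ^s_{p,q}` with `‖W‖_{Ḃ^s_{p,q}} ≤ M`. [cite: WangZhang2016, §4 Step 1] -/
theorem exists_tendsto_isDistributionOf_of_tendsto_integral {s : ℝ} (hs : -2 < s) (hs0 : s < 0)
    (p : ℝ≥0∞) [Fact (1 ≤ p)] {q : ℝ≥0∞} (hq : q ≠ 0) {M : ℝ≥0}
    {u : ℕ → E → EuclideanSpace ℝ ι} {U : ℕ → 𝓢'(E, EuclideanSpace ℂ ι)}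
    (hU : ∀ n, IsDistributionOf (u n) (U n))
    (hmem : ∀ n, FunctionSpaces.MemHomBesov s p q (U n))
    (hM : ∀ n, FunctionSpaces.eHomBesovNorm s p q (U n) ≤ M)
    {w : E → EuclideanSpace ℝ ι} (hwm : AEStronglyMeasurable w volume)
    (hw : ∀ θ : 𝓢(E, ℂ), Integrable (fun x => θ x • complexify (w x)))
    (hconv : ∀ θ : 𝓢(E, ℂ), HasCompactSupport (θ : E → ℂ) →
      Tendsto (fun n => ∫ x, θ x • complexify (u n x)) atTop
        (𝓝 (∫ x, θ x • complexify (w x)))) :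
    ∃ W : 𝓢'(E, EuclideanSpace ℂ ι), Tendsto U atTop (𝓝 W) ∧ IsDistributionOf w W ∧
      FunctionSpaces.MemHomBesov s p q W ∧ FunctionSpaces.eHomBesovNorm s p q W ≤ M := by
  -- the distribution of `w`
  obtain ⟨W₀, hW₀⟩ := exists_isDistributionOf_of_forall_integrable hwm hw
  -- the weak-* limit of `U n`, with prescribed compactly supported pairings
  have hconv' : ∀ θ : 𝓢(E, ℂ), HasCompactSupport (θ : E → ℂ) →
      Tendsto (fun n => U n θ) atTop (𝓝 (∫ x, θ x • complexify (w x))) := fun θ hθ => by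
    have e : (fun n => U n θ) = fun n => ∫ x, θ x • complexify (u n x) :=
      funext fun n => ((hU n) θ).2
    rw [e]
    exact hconv θ hθ
  obtain ⟨W, hWlim, hWmem, hWM, hWθ⟩ :=
    FunctionSpaces.exists_tendsto_of_forall_hasCompactSupport_tendsto' hs hs0 p hq hmem hM hconv'
  -- `W = W₀` (they agree on compactly supported tests)
  have hWW₀ : W = W₀ :=
    FunctionSpaces.TemperedDistribution.eq_of_forall_hasCompactSupport_apply_eq fun θ hθ => by
      rw [hWθ θ hθ, (hW₀ θ).2]
  exact ⟨W, hWlim, hWW₀ ▸ hW₀, hWmem, hWM⟩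

end Literature.Analysis.FluidPDE

end
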